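import Summits.QuantumFields.QCD.Theses.SpectralDefectExtinction
import Summits.QuantumFields.QCD.Theorems.ExtinctionBuildsQCD.Negative.ExtinctIntegrable
import Summits.QuantumFields.QCD.Theorems.SpectralDefectExtinctionWindowExtinctionCornerTwoLineAssemblyAux
import Summits.QuantumFields.QCD.Theorems.SpectralDefectExtinctionWindowExtinctionCornerTwoLineAssemblyAux2

/-!
# Stub `stub_twoLineAssembly` (S2e) of line `corner-decorrelation-deep-hole` — the assembly
(crux `Summit.QuantumFields.QCD.Theses.SpectralDefectExtinction.WindowExtinction`, item stmt-QuantumFields-18063)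

**Bookkeeping stub (registered signature, proved).**  The deterministic pricing DET of `θ`-flat fermion
fields supported in a ball (a flat field forces a dense grid-resonant box of sides in `[ℓ, 2ℓ)` nearby) and
the resonance large deviation LD on boxes (phase-quenched probability `≤ C e^{−cℓ⁴}` of a dense resonant box,
widths `ε ≤ √(κ₀/β)`) imply the TWO-LINE DECAY: the `∏_f |det D_W(U, μ_f, 1)|`-weighted Wilson mean of
`‖K_Uⁿ‖_F²`, `K_U = 4·1 − D_W(U,0,1)`, is `≤ C (2S+1)⁴ (4 − c₁/β)^{2n}` for `β ≥ 1`, `2S+1 ≥ C₀√β`,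
`1 ≤ n ≤ β³`.

Proof (all ingredients landed in the two auxiliary files):
* constants: `c₁ = min(2⁻²⁵, κ₀/512, c/2²⁵)` (so `c₁ ≤ 2⁻²⁵`, `2²⁵c₁³ ≤ c`, `512 c₁ ≤ κ₀`),
  `θ = c₁/(4β)`, `ℓ = ⌊√(β/(1024c₁))⌋` (`2 ≤ ℓ`, `ℓ²θ ≤ 1/4096`, `2ℓ ≤ C₀√β ≤ 2S+1` with
  `C₀ = 2/√(1024c₁)`), grid range `K_f = ⌊π/√(512θ) + 1⌋`, width `√(2048θ) = √(512c₁/β) ≤ √(κ₀/β)`;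
* pathwise: `‖K_Uⁿ‖_F² = Σ_q ‖K_Uⁿ e_q‖²` (`cornerAsm_frob_eq_sum_col`) and every column obeys
  `‖K_Uⁿ e_q‖² ≤ 4(4(1−θ))^{2n} + 16ⁿ Σ_{(k,a,m) ∈ I_q} 1[box event]` (`cornerAsm_col_le`, fed with DET);
* mean: the union bound `cornerAsm_ratio_le` over the index set `T = Σ_q I_q` (`#T = 12(2S+1)⁴ ·
  (2K_f+1)(2n+2ℓ+2)⁴ℓ⁴`), each box event having weighted mean `≤ C_{LD} e^{−cℓ⁴}` by LD (the events are
  measurable, `cornerAsm_measurable_boxEvent`; the weight is integrable, `integrable_mul_weight`);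
* numbers: `12(2S+1)⁴ · 4(4(1−θ))^{2n} = 48(2S+1)⁴(4 − c₁/β)^{2n}` and
  `16ⁿ #I_q e^{−cℓ⁴} ≤ M (4 − c₁/β)^{2n}` (`cornerAsm_asymptotics`), so `C = 48 + 12 C_{LD} M`.
-/

noncomputable section

namespace Summit.QuantumFields.QCD.Cruxes.WindowExtinction.CornerDecorrelationDeepHole

open scoped BigOperators Topology Classical Matrix
open Filter MeasureTheory
open Literature.MathematicalPhysics.QuantumLattice Literature.MathematicalPhysics.QuantumFieldTheory
  Literature.Probability.LatticeModels
open Summit.QuantumFields.QCD.Theorems.ExtinctionBuildsQCD.Negative (integrable_mul_weight)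

/-! ## Counting the index sets -/

/-- The number of quark indices on the torus of side `L` is `12 L⁴`. -/
theorem cornerAsm_card_quarkIdx (L : ℕ) [NeZero L] : Fintype.card (QuarkIdx L) = 12 * L ^ 4 := by
  simp only [QuarkIdx, TorusSite, Fintype.card_prod, Fintype.card_pi, ZMod.card, Finset.prod_const,
    Finset.card_univ, Fintype.card_fin]
  ring

/-- The cardinality of the per-column index set of grid indices, corners and side lengths. -/
theorem cornerAsm_card_indexSet (Kf n ℓ : ℕ) (x : Fin 4 → ℤ) :
    (Finset.Icc (-(Kf : ℤ)) (Kf : ℤ) ×ˢ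
        ((Fintype.piFinset fun i : Fin 4 => Finset.Icc (x i - (n : ℤ) - 2 * (ℓ : ℤ)) (x i + (n : ℤ) + 1)) ×ˢ
          (Fintype.piFinset fun _ : Fin 4 => Finset.Ico ℓ (2 * ℓ)))).card =
      (2 * Kf + 1) * (2 * n + 2 * ℓ + 2) ^ 4 * ℓ ^ 4 := by
  rw [Finset.card_product, Finset.card_product, Fintype.card_piFinset, Fintype.card_piFinset,
    Int.card_Icc]
  have h1 : ((Kf : ℤ) + 1 - -(Kf : ℤ)).toNat = 2 * Kf + 1 := by
    have : (Kf : ℤ) + 1 - -(Kf : ℤ) = ((2 * Kf + 1 : ℕ) : ℤ) := by push_cast; ring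
    rw [this, Int.toNat_natCast]
  have h2 : ∀ i : Fin 4, (Finset.Icc (x i - (n : ℤ) - 2 * (ℓ : ℤ)) (x i + (n : ℤ) + 1)).card =
      2 * n + 2 * ℓ + 2 := by
    intro i
    rw [Int.card_Icc]
    have : x i + (n : ℤ) + 1 + 1 - (x i - (n : ℤ) - 2 * (ℓ : ℤ)) = ((2 * n + 2 * ℓ + 2 : ℕ) : ℤ) := by
      push_cast; ring
    rw [this, Int.toNat_natCast]
  have h3 : (Finset.Ico ℓ (2 * ℓ)).card = ℓ := by
    rw [Nat.card_Ico]; omega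
  rw [h1, Finset.prod_congr rfl fun i _ => h2 i, h3, Finset.prod_const, Finset.prod_const,
    Finset.card_univ, Fintype.card_fin]
  ring

/-! ## The stub -/

/-- **S2e · ASSEMBLY OF THE TWO-LINE DECAY** (registered stub `stub_twoLineAssembly` of line
`corner-decorrelation-deep-hole`, crux `WindowExtinction`, item stmt-QuantumFields-18063).  DET (flat column
supported in a ball ⇒ dense grid-resonant box nearby) and the box resonance large deviation LD imply the
annealed two-line decay: there are `c₁, C, C₀ > 0` such that for every `N_f ≤ 3`, every `β ≥ 1`, every odd
torus of side `2S+1 ≥ C₀√β`, every bare-mass tuple `μ_f ≥ −1` and every path length `1 ≤ n ≤ β³`, the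
`∏_f |det D_W(U, μ_f, 1)|`-weighted Wilson-measure mean of `‖(4·1 − D_W(U,0,1))ⁿ‖_F²` is at most
`C (2S+1)⁴ (4 − c₁/β)^{2n}`. -/
theorem stub_twoLineAssembly :
    (∀ (L : ℕ) [NeZero L] (U : GaugeConfig 4 L SU3) (θ : ℝ) (ℓ n : ℕ) (x : TorusSite 4 L) (ψ : QuarkIdx L → ℂ),
0 < θ → 2 ≤ ℓ → 2 * ℓ ≤ L → (ℓ : ℝ) ^ 2 * θ ≤ 1 / 4096 →
(∀ p, ψ p ≠ 0 → ∃ v ∈ box 4 n, p.1 = x + Torus.proj L v) →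
0 < ∑ p, ‖ψ p‖ ^ 2 →
4 * (1 - θ) * (∑ p, ‖ψ p‖ ^ 2) ≤
‖∑ p, star (ψ p) * ((∑ μ, wilsonHop (fundamentalRep (Fin 3)) U μ) *ᵥ ψ) p‖ →
∃ k : ℤ, (|k| : ℝ) ≤ Real.pi / Real.sqrt (512 * θ) + 1 ∧
∃ a : Fin 4 → ℤ, (∀ i, ((x i).val : ℤ) - n - 2 * ℓ ≤ a i ∧ a i ≤ ((x i).val : ℤ) + n + 1) ∧
∃ m : Fin 4 → ℕ, (∀ i, ℓ ≤ m i ∧ m i < 2 * ℓ) ∧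
(∏ i, m i) ≤ 16 * ((Fintype.piFinset fun i => Finset.Ico (a i) (a i + m i)).filter
(fun v => 1 ≤ Multiset.countP
(fun w : ℂ => ‖w - Complex.exp (↑((k : ℝ) * Real.sqrt (512 * θ)) * Complex.I)‖ ≤ Real.sqrt (2048 * θ))
(fundamentalRep (Fin 3) (plaquetteHolonomy U (Torus.proj L v) 0 1)).charpoly.roots)).card) →
    (∃ κ₀ c C : ℝ, 0 < κ₀ ∧ 0 < c ∧ 0 < C ∧ ∀ Nf : ℕ, Nf ≤ 3 → ∀ β : ℝ, 1 ≤ β → ∀ (L : ℕ) [NeZero L],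
∀ (μ : Fin Nf → ℝ) (ℓ : ℕ), 2 ≤ ℓ → 2 * ℓ ≤ L → ∀ (a : Fin 4 → ℤ) (m : Fin 4 → ℕ),
(∀ i, ℓ ≤ m i ∧ m i < 2 * ℓ) → ∀ (φ₀ ε : ℝ), 0 < ε → ε ≤ Real.sqrt (κ₀ / β) →
∫ U : GaugeConfig 4 L SU3,
(if (∏ i, m i) ≤ 16 * ((Fintype.piFinset fun i => Finset.Ico (a i) (a i + m i)).filter
(fun v => 1 ≤ Multiset.countP (fun w : ℂ => ‖w - Complex.exp (↑φ₀ * Complex.I)‖ ≤ ε)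
(fundamentalRep (Fin 3) (plaquetteHolonomy U (Torus.proj L v) 0 1)).charpoly.roots)).card
then (1 : ℝ) else 0) *
∏ f, ‖fermionDet (wilsonDirac (fundamentalRep (Fin 3)) U (μ f) 1)‖ ∂(wilsonMeasure (fundamentalRep (Fin 3)) β) ≤
C * Real.exp (-(c * (ℓ : ℝ) ^ 4)) *
∫ U : GaugeConfig 4 L SU3, ∏ f, ‖fermionDet (wilsonDirac (fundamentalRep (Fin 3)) U (μ f) 1)‖
∂(wilsonMeasure (fundamentalRep (Fin 3)) β)) →
    ∃ c₁ C C₀ : ℝ, 0 < c₁ ∧ 0 < C ∧ 0 < C₀ ∧ ∀ Nf : ℕ, Nf ≤ 3 → ∀ β : ℝ, 1 ≤ β → ∀ S : ℕ, C₀ * Real.sqrt β ≤ 2 * S + 1 → ∀ μ : Fin Nf → ℝ, (∀ f, -1 ≤ μ f) → ∀ n : ℕ, 1 ≤ n → (n : ℝ) ≤ β ^ 3 → (∫ U : GaugeConfig 4 (2 * S + 1) ↥(Matrix.specialUnitaryGroup (Fin 3) ℂ), (∑ i, ∑ j, ‖(((4 : ℂ) • (1 : Matrix (QuarkIdx (2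 * S + 1)) (QuarkIdx (2 * S + 1)) ℂ) - wilsonDirac (fundamentalRep (Fin 3)) U 0 1) ^ n) i j‖ ^ 2) * ∏ f : Fin Nf, ‖fermionDet (wilsonDirac (fundamentalRep (Fin 3)) U (μ f) 1)‖ ∂(wilsonMeasure (fundamentalRep (Fin 3)) β)) / (∫ U : GaugeConfig 4 (2 * S + 1) ↥(Matrix.specialUnitaryGroup (Fin 3) ℂ), ∏ f : Fin Nf, ‖fermionDet (wilsonDirac (fundamentalRep (Fin 3)) U (μ f) 1)‖ ∂(wilsonMeasure (fundamentalRep (Fin 3)) β)) ≤ C * (2 * S + 1 : ℝ) ^ 4 * (4 - c₁ / β) ^ (2 * n) := by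
  intro hDET hLD
  obtain ⟨κ₀, c, CLD, hκ₀, hc, hCLD, hLD⟩ := hLD
  -- the constants
  set c₁ : ℝ := min (1 / 2 ^ 25) (min (κ₀ / 512) (c / 2 ^ 25)) with hc₁def
  have hc₁ : 0 < c₁ := lt_min (by norm_num) (lt_min (by positivity) (by positivity))
  have hc₁1 : c₁ ≤ 1 / 2 ^ 25 := min_le_left _ _
  have hc₁κ : c₁ ≤ κ₀ / 512 := (min_le_right _ _).trans (min_le_left _ _)
  have hc₁c' : c₁ ≤ c / 2 ^ 25 := (min_le_right _ _).trans (min_le_right _ _)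
  have hc₁le1 : c₁ ≤ 1 := hc₁1.trans (by norm_num)
  have hc₁c : 2 ^ 25 * c₁ ^ 3 ≤ c := by
    have h1 : c₁ ^ 3 ≤ c₁ := by
      have : c₁ ^ 3 ≤ c₁ ^ 1 := pow_le_pow_of_le_one hc₁.le hc₁le1 (by norm_num)
      simpa using this
    have h2 : 2 ^ 25 * c₁ ≤ c := by
      rw [le_div_iff₀ (by positivity)] at hc₁c'
      linarith
    nlinarith
  obtain ⟨M, hM0, hM⟩ := cornerAsm_asymptotics hc₁ hc₁1 hc₁c
  refine ⟨c₁, 48 + 12 * CLD * M, 2 / Real.sqrt (1024 * c₁), hc₁, by positivity, by positivity, ?_⟩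
  intro Nf hNf β hβ S hS μ hμ n hn hnβ
  have hβ0 : 0 < β := by linarith
  have hβne : β ≠ 0 := hβ0.ne'
  -- `θ`
  obtain ⟨θ, hθdef⟩ : ∃ θ : ℝ, θ = c₁ / (4 * β) := ⟨_, rfl⟩
  have hθ0 : 0 < θ := by rw [hθdef]; positivity
  have hθ1 : θ ≤ 1 := by
    rw [hθdef, div_le_iff₀ (by positivity)]
    nlinarith
  have hrate : 4 * (1 - θ) = 4 - c₁ / β := by
    rw [hθdef, mul_sub, mul_one, mul_div_assoc', mul_div_mul_left c₁ β (by norm_num : (4 : ℝ) ≠ 0)]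
  -- `ℓ`
  obtain ⟨r, hrdef⟩ : ∃ r : ℝ, r = Real.sqrt (β / (1024 * c₁)) := ⟨_, rfl⟩
  have hr0 : 0 ≤ r := by rw [hrdef]; exact Real.sqrt_nonneg _
  obtain ⟨ℓ, hℓdef⟩ : ∃ ℓ : ℕ, ℓ = ⌊r⌋₊ := ⟨_, rfl⟩
  have hℓr : (ℓ : ℝ) ≤ r := by rw [hℓdef]; exact Nat.floor_le hr0
  have hrℓ : r < ℓ + 1 := by rw [hℓdef]; exact Nat.lt_floor_add_one r
  have hr2 : (2 : ℝ) ≤ r := by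
    rw [hrdef]
    refine Real.le_sqrt_of_sq_le ?_
    rw [le_div_iff₀ (by positivity)]
    nlinarith
  have hℓ2 : 2 ≤ ℓ := by
    rw [hℓdef]
    exact Nat.le_floor (by exact_mod_cast hr2)
  have hC₀r : 2 / Real.sqrt (1024 * c₁) * Real.sqrt β = 2 * r := by
    rw [hrdef, Real.sqrt_div' β (by positivity : (0 : ℝ) ≤ 1024 * c₁)]
    ring
  have h2ℓL : 2 * ℓ ≤ 2 * S + 1 := by
    have h1 : (2 * ℓ : ℝ) ≤ 2 * S + 1 := by
      calc (2 * ℓ : ℝ) ≤ 2 * r := by linarith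
        _ = 2 / Real.sqrt (1024 * c₁) * Real.sqrt β := hC₀r.symm
        _ ≤ 2 * S + 1 := hS
    exact_mod_cast h1
  have hℓθ : (ℓ : ℝ) ^ 2 * θ ≤ 1 / 4096 := by
    have h1 : (ℓ : ℝ) ^ 2 ≤ r ^ 2 := pow_le_pow_left₀ (Nat.cast_nonneg _) hℓr 2
    have h2 : r ^ 2 = β / (1024 * c₁) := by rw [hrdef]; exact Real.sq_sqrt (by positivity)
    have h3 : β / (1024 * c₁) * θ = 1 / 4096 := by
      rw [hθdef, div_mul_div_comm, div_eq_div_iff (by positivity) (by norm_num)]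
      ring
    calc (ℓ : ℝ) ^ 2 * θ ≤ r ^ 2 * θ := mul_le_mul_of_nonneg_right h1 hθ0.le
      _ = 1 / 4096 := by rw [h2, h3]
  have hℓrr : (ℓ : ℝ) ≤ Real.sqrt (β / (1024 * c₁)) := by rw [← hrdef]; exact hℓr
  have hrrℓ : Real.sqrt (β / (1024 * c₁)) < ℓ + 1 := by rw [← hrdef]; exact hrℓ
  -- the grid range `K_f`
  obtain ⟨Kr, hKrdef⟩ : ∃ Kr : ℝ, Kr = Real.pi / Real.sqrt (512 * θ) + 1 := ⟨_, rfl⟩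
  have hKr0 : 0 ≤ Kr := by rw [hKrdef]; positivity
  obtain ⟨Kf, hKfdef⟩ : ∃ Kf : ℕ, Kf = ⌊Kr⌋₊ := ⟨_, rfl⟩
  have hKf : (Kf : ℝ) ≤ Real.pi / Real.sqrt (512 * (c₁ / (4 * β))) + 1 := by
    rw [hKfdef, ← hθdef, ← hKrdef]; exact Nat.floor_le hKr0
  have hKf' : Real.pi / Real.sqrt (512 * θ) + 1 < Kf + 1 := by
    rw [hKfdef, ← hKrdef]; exact Nat.lt_floor_add_one Kr
  -- the width
  have hε : 0 < Real.sqrt (2048 * θ) := Real.sqrt_pos.2 (by positivity)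
  have hεκ : Real.sqrt (2048 * θ) ≤ Real.sqrt (κ₀ / β) := by
    refine Real.sqrt_le_sqrt ?_
    have e : 2048 * θ = 512 * c₁ / β := by
      rw [hθdef, mul_div_assoc', div_eq_div_iff (by positivity) hβne]
      ring
    rw [e, div_le_div_iff_of_pos_right hβ0]
    have := (le_div_iff₀ (by norm_num : (0 : ℝ) < 512)).1 hc₁κ
    linarith
  -- the box-event indicator and the per-column index sets
  obtain ⟨ind, hind⟩ : ∃ ind : ℤ × (Fin 4 → ℤ) × (Fin 4 → ℕ) → GaugeConfig 4 (2 * S + 1) SU3 → ℝ,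
      ind = fun t U =>
        if (∏ i, t.2.2 i) ≤ 16 * ((Fintype.piFinset fun i : Fin 4 => Finset.Ico (t.2.1 i) (t.2.1 i + (t.2.2 i : ℤ))).filter
            (fun v => 1 ≤ Multiset.countP
              (fun w : ℂ => ‖w - Complex.exp (↑((t.1 : ℝ) * Real.sqrt (512 * θ)) * Complex.I)‖ ≤
                Real.sqrt (2048 * θ))
              (fundamentalRep (Fin 3) (plaquetteHolonomy U (Torus.proj (2 * S + 1) v) 0 1)).charpoly.roots)).card
        then (1 : ℝ) else 0 := ⟨_, rfl⟩
  obtain ⟨I, hI⟩ : ∃ I : QuarkIdx (2 * S + 1) → Finset (ℤ × (Fin 4 → ℤ) × (Fin 4 → ℕ)),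
      I = fun q => Finset.Icc (-(Kf : ℤ)) (Kf : ℤ) ×ˢ
        ((Fintype.piFinset fun i : Fin 4 =>
            Finset.Icc (((q.1 i).val : ℤ) - (n : ℤ) - 2 * (ℓ : ℤ)) (((q.1 i).val : ℤ) + (n : ℤ) + 1)) ×ˢ
          (Fintype.piFinset fun _ : Fin 4 => Finset.Ico ℓ (2 * ℓ))) := ⟨_, rfl⟩
  obtain ⟨T, hT⟩ : ∃ T : Finset (Σ _ : QuarkIdx (2 * S + 1), ℤ × (Fin 4 → ℤ) × (Fin 4 → ℕ)),
      T = (Finset.univ : Finset (QuarkIdx (2 * S + 1))).sigma I := ⟨_, rfl⟩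
  -- the weight and the functional
  obtain ⟨w, hw⟩ : ∃ w : GaugeConfig 4 (2 * S + 1) SU3 → ℝ,
      w = fun U => ∏ f : Fin Nf, ‖fermionDet (wilsonDirac (fundamentalRep (Fin 3)) U (μ f) 1)‖ := ⟨_, rfl⟩
  obtain ⟨F, hF⟩ : ∃ F : GaugeConfig 4 (2 * S + 1) SU3 → ℝ,
      F = fun U => ∑ i, ∑ j, ‖(((4 : ℂ) • (1 : Matrix (QuarkIdx (2 * S + 1)) (QuarkIdx (2 * S + 1)) ℂ) -
        wilsonDirac (fundamentalRep (Fin 3)) U 0 1) ^ n) i j‖ ^ 2 := ⟨_, rfl⟩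
  have hw0 : ∀ U, 0 ≤ w U := fun U => by rw [hw]; exact Finset.prod_nonneg fun f _ => norm_nonneg _
  have hF0 : ∀ U, 0 ≤ F U := fun U => by rw [hF]; positivity
  have hind0 : ∀ t U, 0 ≤ ind t U := fun t U => by
    simp only [hind]
    split_ifs <;> norm_num
  have hind1 : ∀ t U, ind t U ≤ 1 := fun t U => by
    simp only [hind]
    split_ifs <;> norm_num
  -- pathwise bound
  obtain ⟨A, hA⟩ : ∃ A : ℝ, A = (Fintype.card (QuarkIdx (2 * S + 1)) : ℝ) * (4 * (4 * (1 - θ)) ^ (2 * n)) :=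
    ⟨_, rfl⟩
  have hA0 : 0 ≤ A := by
    have h4 : 0 ≤ 4 * (1 - θ) := by linarith
    rw [hA]
    exact mul_nonneg (Nat.cast_nonneg _) (mul_nonneg (by norm_num) (pow_nonneg h4 _))
  have hTsum : ∀ U, ∑ s ∈ T, ind s.2 U = ∑ q, ∑ t ∈ I q, ind t U := fun U => by
    simp only [hT, Finset.sum_sigma]
  have hpath : ∀ U, F U ≤ A + 16 ^ n * ∑ s ∈ T, ind s.2 U := by
    intro U
    have hcol : ∀ q : QuarkIdx (2 * S + 1),
        ∑ p, ‖((∑ ν, wilsonHop (fundamentalRep (Fin 3)) U ν) ^ n *ᵥ Pi.single q 1) p‖ ^ 2 ≤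
          4 * (4 * (1 - θ)) ^ (2 * n) + 16 ^ n * ∑ t ∈ I q, ind t U := by
      intro q
      have h := cornerAsm_col_le (2 * S + 1) U hθ1 hn ℓ Kf hKf' q
        (fun ψ hsupp hpos hflat => hDET (2 * S + 1) U θ ℓ n q.1 ψ hθ0 hℓ2 h2ℓL hℓθ hsupp hpos hflat)
      simp only [hI, hind]
      exact h
    have hFeq : F U = ∑ q, ∑ p, ‖((∑ ν, wilsonHop (fundamentalRep (Fin 3)) U ν) ^ n *ᵥ Pi.single q 1) p‖ ^ 2 := by
      simp only [hF]
      rw [cornerAsm_four_smul_one_sub_wilsonDirac, cornerAsm_frob_eq_sum_col]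
    rw [hFeq, hTsum U]
    calc ∑ q, ∑ p, ‖((∑ ν, wilsonHop (fundamentalRep (Fin 3)) U ν) ^ n *ᵥ Pi.single q 1) p‖ ^ 2
        ≤ ∑ q, (4 * (4 * (1 - θ)) ^ (2 * n) + 16 ^ n * ∑ t ∈ I q, ind t U) :=
          Finset.sum_le_sum fun q _ => hcol q
      _ = A + 16 ^ n * ∑ q, ∑ t ∈ I q, ind t U := by
          rw [Finset.sum_add_distrib, Finset.sum_const, Finset.card_univ, nsmul_eq_mul, ← Finset.mul_sum, hA]
  -- integrability
  have hwi : Integrable w (wilsonMeasure (d := 4) (L := 2 * S + 1) (fundamentalRep (Fin 3)) β) := by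
    have h := integrable_mul_weight (L := 2 * S + 1) μ β (φ := fun _ => (1 : ℝ)) measurable_const (C := 1)
      (fun _ => by simp)
    simp only [hw]
    simpa only [one_mul] using h
  have hmeas : ∀ t : ℤ × (Fin 4 → ℤ) × (Fin 4 → ℕ), Measurable (ind t) := fun t => by
    simp only [hind]
    exact cornerAsm_measurable_boxEvent (2 * S + 1) (∏ i, t.2.2 i)
      (Fintype.piFinset fun i : Fin 4 => Finset.Ico (t.2.1 i) (t.2.1 i + (t.2.2 i : ℤ)))
      ((t.1 : ℝ) * Real.sqrt (512 * θ)) (Real.sqrt (2048 * θ))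
  have hei : ∀ s ∈ T, Integrable (fun U => ind s.2 U * w U)
      (wilsonMeasure (d := 4) (L := 2 * S + 1) (fundamentalRep (Fin 3)) β) := fun s _ => by
    simp only [hw]
    exact integrable_mul_weight (L := 2 * S + 1) μ β (hmeas s.2) (C := 1)
      (fun U => by rw [abs_of_nonneg (hind0 _ U)]; exact hind1 _ U)
  -- the large deviation bound for every box event in `T`
  obtain ⟨δ, hδ⟩ : ∃ δ : ℝ, δ = CLD * Real.exp (-(c * (ℓ : ℝ) ^ 4)) := ⟨_, rfl⟩
  have hδ0 : 0 ≤ δ := by rw [hδ]; positivity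
  have he : ∀ s ∈ T, ∫ U, ind s.2 U * w U ∂(wilsonMeasure (d := 4) (L := 2 * S + 1) (fundamentalRep (Fin 3)) β) ≤
      δ * ∫ U, w U ∂(wilsonMeasure (d := 4) (L := 2 * S + 1) (fundamentalRep (Fin 3)) β) := by
    intro s hs
    obtain ⟨q, k, a, m⟩ := s
    rw [hT] at hs
    have hkm : (k, a, m) ∈ I q := (Finset.mem_sigma.1 hs).2
    simp only [hI] at hkm
    have hm' : m ∈ Fintype.piFinset fun _ : Fin 4 => Finset.Ico ℓ (2 * ℓ) :=
      (Finset.mem_product.1 (Finset.mem_product.1 hkm).2).2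
    have hm : ∀ i, ℓ ≤ m i ∧ m i < 2 * ℓ := fun i => Finset.mem_Ico.1 (Fintype.mem_piFinset.1 hm' i)
    have h := hLD Nf hNf β hβ (2 * S + 1) μ ℓ hℓ2 h2ℓL a m hm ((k : ℝ) * Real.sqrt (512 * θ))
      (Real.sqrt (2048 * θ)) hε hεκ
    simp only [hind, hw, hδ]
    exact h
  -- the union bound in phase-quenched mean
  have hratio := cornerAsm_ratio_le (wilsonMeasure (d := 4) (L := 2 * S + 1) (fundamentalRep (Fin 3)) β) T
    hw0 hF0 hA0 (by positivity : (0 : ℝ) ≤ 16 ^ n) hδ0 hpath hwi hei he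
  -- counting `T`
  have hcardTn : T.card = (2 * Kf + 1) * (2 * n + 2 * ℓ + 2) ^ 4 * ℓ ^ 4 * (12 * (2 * S + 1) ^ 4) := by
    have h1 : T.card = ∑ q : QuarkIdx (2 * S + 1), (I q).card := by rw [hT, Finset.card_sigma]
    have h2 : ∀ q : QuarkIdx (2 * S + 1), (I q).card = (2 * Kf + 1) * (2 * n + 2 * ℓ + 2) ^ 4 * ℓ ^ 4 :=
      fun q => by simp only [hI]; exact cornerAsm_card_indexSet Kf n ℓ (fun i => ((q.1 i).val : ℤ))
    rw [h1, Finset.sum_congr rfl fun q _ => h2 q, Finset.sum_const, Finset.card_univ,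
      cornerAsm_card_quarkIdx, smul_eq_mul]
    ring
  have hcardT : (T.card : ℝ) =
      12 * (2 * S + 1 : ℝ) ^ 4 * ((2 * Kf + 1) * (2 * n + 2 * ℓ + 2) ^ 4 * (ℓ : ℝ) ^ 4) := by
    rw [hcardTn]
    push_cast
    ring
  have hcardQ : (Fintype.card (QuarkIdx (2 * S + 1)) : ℝ) = 12 * (2 * S + 1 : ℝ) ^ 4 := by
    exact_mod_cast cornerAsm_card_quarkIdx (2 * S + 1)
  -- asymptotics
  have hasym := hM β hβ n hnβ ℓ Kf hℓrr hrrℓ hKf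
  -- assembly of the numbers
  have hA1 : A = 48 * (2 * S + 1 : ℝ) ^ 4 * (4 - c₁ / β) ^ (2 * n) := by
    rw [hA, hcardQ, hrate]; ring
  have hT1 : (16 : ℝ) ^ n * ((T.card : ℝ) * δ) ≤
      12 * (2 * S + 1 : ℝ) ^ 4 * CLD * (M * (4 - c₁ / β) ^ (2 * n)) := by
    have e : (16 : ℝ) ^ n * ((T.card : ℝ) * δ) = 12 * (2 * S + 1 : ℝ) ^ 4 * CLD *
        (16 ^ n * ((2 * Kf + 1) * (2 * n + 2 * ℓ + 2) ^ 4 * (ℓ : ℝ) ^ 4) * Real.exp (-(c * (ℓ : ℝ) ^ 4))) := by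
      rw [hcardT, hδ]; ring
    rw [e]
    exact mul_le_mul_of_nonneg_left hasym (by positivity)
  have hfin : A + 16 ^ n * ((T.card : ℝ) * δ) ≤ (48 + 12 * CLD * M) * (2 * S + 1 : ℝ) ^ 4 * (4 - c₁ / β) ^ (2 * n) := by
    calc A + 16 ^ n * ((T.card : ℝ) * δ)
        ≤ 48 * (2 * S + 1 : ℝ) ^ 4 * (4 - c₁ / β) ^ (2 * n) +
          12 * (2 * S + 1 : ℝ) ^ 4 * CLD * (M * (4 - c₁ / β) ^ (2 * n)) := add_le_add hA1.le hT1
      _ = (48 + 12 * CLD * M) * (2 * S + 1 : ℝ) ^ 4 * (4 - c₁ / β) ^ (2 * n) := by ring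
  simp only [hF, hw] at hratio
  exact hratio.trans hfin

end Summit.QuantumFields.QCD.Cruxes.WindowExtinction.CornerDecorrelationDeepHole

end
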